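import Summits.NavierStokesRegularity.FunctionalMining.TopEigGapCutoffPowDensity
import Mathlib.Analysis.Calculus.LHopital
import HarnessLib

/-!
# FunctionalMining — second differences of `λ₁` at a SIMPLE point: `Σₖ∂ₖ∂ₖλ₁ = μ + 2R` and
# `(λ₁(x+teₖ) + λ₁(x−teₖ) − 2λ₁(x))/t² → ∂ₖ∂ₖλ₁(x)`

HONEST FRAMING. Search for candidate a priori estimates; no regularity claim. Cell `pub-nsfunc`, prove
seat (gen 32). Pointwise calculus at a point `x` of the simple set `U_s = {λ₂ < λ₁}` of the strain of a
smooth field on `T³` (where `λ₁` is chart-`C^∞`, tree `contDiffAt_liftAt_torusStrainTopEig_of_midEig_lt`):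
`sum_partialDeriv_partialDeriv_topEig_eq_of_simple` (`Σₖ∂ₖ∂ₖλ₁(x) = μ(S(x);S(Δv)(x)) + 2·topChannelW v x`,
the tree's R-form `laplacian_torusStrainTopEig_eq_sum_frame` + the frame form of the Danskin value),
`hasDerivAt_topEig_coordLine_at` (derivative of `t ↦ λ₁(x + teₖ)` at every simple point of the line) and
**`tendsto_secondDiff_topEig_div_sq`**: the symmetric second difference quotient of `λ₁` along `eₖ`
converges to `∂ₖ∂ₖλ₁(x)` as `t → 0⁺` (l'Hôpital once, then the symmetric difference quotient of
`s ↦ ∂ₖλ₁(x + seₖ)`). Input of `TopEigChannelFloor` (the channel floor of the heat price for EVERY smooth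
field). NOT CLAIMED: anything at non-simple points; anything about L-λ. [ours; folklore calculus]
FILING (prove seat g32, SLOT OWN-C1, granted AT-ONCE by LEAD (58v) INBOX l.5760): = staged `pub-nsfunc-prove/staged/g32-own/TopEigSecondDiffSimple.lean` 3b319f3fd231962f; this line is the only addition.
-/

noncomputable section

open Filter Topology Matrix Finset MeasureTheory Set
open scoped ContDiff ENNReal

namespace Summit.NavierStokesRegularity.FunctionalMining

open Literature.Analysis Literature.Analysis.FunctionSpaces Literature.Analysis.FunctionSpaces.Torus
  SharpClass.DirectorForm Literature.Analysis.Matrix StrainL4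

namespace TopEig

variable {v : UnitAddTorus (Fin 3) → EuclideanSpace ℝ (Fin 3)}

/-! ## 1. At a simple point: `Σₖ∂ₖ∂ₖλ₁ = μ + 2R`, and the second difference quotient converges -/

/-- **At a simple point, `Σₖ ∂ₖ∂ₖλ₁(x) = μ(S(x); S(Δv)(x)) + 2·topChannelW v x`** (the tree's R-form of
`Δλ₁`, the frame form of the Danskin value, and `Δ = Σₖ∂ₖ∂ₖ` at a chart-smooth point). [ours, bookkeeping] -/
theorem sum_partialDeriv_partialDeriv_topEig_eq_of_simple (hv : Torus.IsSmooth v)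
    {x : UnitAddTorus (Fin 3)} (hx : torusStrainMidEig v x < torusStrainTopEig v x) :
    ∑ k, Torus.partialDeriv k (Torus.partialDeriv k (torusStrainTopEig v)) x =
      dirTopEig (strainFlat v x) (strainFlat (Torus.laplacian v) x) + 2 * topChannelW v x := by
  have hlap : ∑ k, Torus.partialDeriv k (Torus.partialDeriv k (torusStrainTopEig v)) x =
      Torus.laplacian (torusStrainTopEig v) x :=
    (laplacian_eq_sum_partialDeriv_partialDeriv_of_contDiffAt
      ((contDiffAt_liftAt_torusStrainTopEig_of_midEig_lt hv hx).of_le (by norm_cast))).symm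
  obtain ⟨he1, hSe, hgap⟩ := gapForm_eigenvectorBasis hx (eigenvalues_topIndex v x)
  have hg : 0 < torusStrainTopEig v x - torusStrainMidEig v x := sub_pos.2 hx
  have hμ := dirTopEig_strainFlat_eq_of_gapForm he1 hSe hg hgap (Torus.laplacian v)
  have hR := laplacian_torusStrainTopEig_eq_sum_frame hv hx (eigenvalues_topIndex v x)
  rw [ofLp_eigenvectorBasis_topIndex] at hμ hR
  rw [hlap, hR, hμ]
  unfold topChannelW
  rfl

/-- Along the coordinate line through a simple point, `t ↦ λ₁(x + t eₖ)` has derivative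
`∂ₖλ₁(x + s eₖ)` at every `s` with `x + s eₖ` simple. [ours, bookkeeping] -/
theorem hasDerivAt_topEig_coordLine_at (hv : Torus.IsSmooth v) {x : UnitAddTorus (Fin 3)} (k : Fin 3)
    {s : ℝ} (hs : torusStrainMidEig v (x + proj (s • EuclideanSpace.single k (1 : ℝ))) <
      torusStrainTopEig v (x + proj (s • EuclideanSpace.single k (1 : ℝ)))) :
    HasDerivAt (fun t : ℝ => torusStrainTopEig v (x + proj (t • EuclideanSpace.single k (1 : ℝ))))
      (Torus.partialDeriv k (torusStrainTopEig v) (x + proj (s • EuclideanSpace.single k (1 : ℝ)))) s := by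
  have h0 := hasDerivAt_coordLine_of_contDiffAt
    (contDiffAt_liftAt_torusStrainTopEig_of_midEig_lt hv hs) k
  -- shift the base point: `x + proj (t e) = (x + proj (s e)) + proj ((t − s) e)`
  have hshift : (fun t : ℝ => torusStrainTopEig v (x + proj (t • EuclideanSpace.single k (1 : ℝ)))) =
      (fun t : ℝ => torusStrainTopEig v ((x + proj (s • EuclideanSpace.single k (1 : ℝ))) +
        proj (t • EuclideanSpace.single k (1 : ℝ)))) ∘ fun t => t - s := by
    funext t
    simp only [Function.comp]
    rw [add_assoc, ← proj_add, ← add_smul, add_sub_cancel]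
  rw [hshift]
  have h1 : HasDerivAt (fun t : ℝ => t - s) 1 s := by
    simpa using (hasDerivAt_id s).sub_const s
  have h2 := h0.scomp_of_eq s h1 (by simp)
  simpa using h2

/-- **At a simple point the symmetric second difference quotient of `λ₁` along `eₖ` converges to
`∂ₖ∂ₖλ₁`:** `(λ₁(x+teₖ) + λ₁(x−teₖ) − 2λ₁(x))/t² → ∂ₖ∂ₖλ₁(x)` as `t → 0⁺` (l'Hôpital once, then the
symmetric difference quotient of `s ↦ ∂ₖλ₁(x + s eₖ)` at `0`). [ours; folklore calculus] -/
theorem tendsto_secondDiff_topEig_div_sq (hv : Torus.IsSmooth v) {x : UnitAddTorus (Fin 3)}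
    (hx : torusStrainMidEig v x < torusStrainTopEig v x) (k : Fin 3) :
    Tendsto (fun t : ℝ => (torusStrainTopEig v (x + proj (t • EuclideanSpace.single k (1 : ℝ))) +
        torusStrainTopEig v (x + proj ((-t) • EuclideanSpace.single k (1 : ℝ))) -
        2 * torusStrainTopEig v x) / t ^ 2) (𝓝[>] 0)
      (𝓝 (Torus.partialDeriv k (Torus.partialDeriv k (torusStrainTopEig v)) x)) := by
  set L := torusStrainTopEig v with hL
  set e : EuclideanSpace ℝ (Fin 3) := EuclideanSpace.single k (1 : ℝ) with he
  set g : ℝ → ℝ := fun t => L (x + proj (t • e)) with hg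
  set h : ℝ → ℝ := fun t => Torus.partialDeriv k L (x + proj (t • e)) with hh
  set L2 : ℝ := Torus.partialDeriv k (Torus.partialDeriv k L) x with hL2
  -- simplicity persists along the line near `0`
  have hline : Continuous fun t : ℝ => x + proj (t • e) :=
    continuous_const.add (continuous_proj.comp (continuous_id.smul continuous_const))
  have hev : ∀ᶠ t : ℝ in 𝓝 0, torusStrainMidEig v (x + proj (t • e)) < torusStrainTopEig v (x + proj (t • e)) := by
    have hmem : x + proj ((0 : ℝ) • e) ∈ {y | torusStrainMidEig v y < torusStrainTopEig v y} := by
      rw [coordLine_zero]; exact hx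
    exact hline.continuousAt.preimage_mem_nhds ((isOpen_setOf_midEig_lt_topEig hv).mem_nhds hmem)
  -- derivative of `g` near `0`, and of `h` at `0`
  have hg' : ∀ᶠ t : ℝ in 𝓝 0, HasDerivAt g (h t) t := by
    filter_upwards [hev] with t ht
    exact hasDerivAt_topEig_coordLine_at hv k ht
  have hh' : HasDerivAt h L2 0 :=
    hasDerivAt_coordLine_of_contDiffAt (contDiffAt_liftAt_partialDeriv_topEig_of_simple hv hx k) k
  -- the numerator `N t = g t + g(−t) − 2 g 0` and its derivative `h t − h(−t)`
  have hN' : ∀ᶠ t : ℝ in 𝓝[>] 0,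
      HasDerivAt (fun t => g t + g (-t) - 2 * g 0) (h t - h (-t)) t := by
    have hev2 : ∀ᶠ t : ℝ in 𝓝 0, HasDerivAt g (h t) t ∧ HasDerivAt g (h (-t)) (-t) := by
      have hneg : Tendsto (fun t : ℝ => -t) (𝓝 0) (𝓝 0) := by
        simpa using (continuous_neg (G := ℝ)).tendsto 0
      exact hg'.and (hneg.eventually hg')
    refine (hev2.filter_mono nhdsWithin_le_nhds).mono fun t ht => ?_
    have h1 : HasDerivAt (fun t => g (-t)) ((-1 : ℝ) • h (-t)) t := ht.2.scomp t (hasDerivAt_neg t)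
    have h2 := (ht.1.add h1).sub_const (2 * g 0)
    refine h2.congr_deriv ?_
    simp only [smul_eq_mul]
    ring
  have hD' : ∀ᶠ t : ℝ in 𝓝[>] 0, HasDerivAt (fun t : ℝ => t ^ 2) (2 * t) t :=
    Eventually.of_forall fun t => by simpa using hasDerivAt_pow 2 t
  have hD0 : ∀ᶠ t : ℝ in 𝓝[>] 0, 2 * t ≠ 0 := by
    filter_upwards [self_mem_nhdsWithin] with t ht
    exact mul_ne_zero two_ne_zero (ne_of_gt ht)
  -- the numerator and denominator tend to `0`
  have hgc : ContinuousAt g 0 := by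
    have h := hg'.self_of_nhds
    exact h.continuousAt
  have hN0 : Tendsto (fun t => g t + g (-t) - 2 * g 0) (𝓝[>] 0) (𝓝 0) := by
    have h1 : Tendsto g (𝓝 0) (𝓝 (g 0)) := hgc
    have h2 : Tendsto (fun t => g (-t)) (𝓝 0) (𝓝 (g 0)) := by
      have hneg : Tendsto (fun t : ℝ => -t) (𝓝 0) (𝓝 0) := by
        simpa using (continuous_neg (G := ℝ)).tendsto 0
      exact h1.comp hneg
    have h3 := (h1.add h2).sub (tendsto_const_nhds (x := 2 * g 0))
    have e0 : g 0 + g 0 - 2 * g 0 = 0 := by ring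
    rw [e0] at h3
    exact h3.mono_left nhdsWithin_le_nhds
  have hDlim : Tendsto (fun t : ℝ => t ^ 2) (𝓝[>] 0) (𝓝 0) := by
    have h := (continuous_pow 2 (M := ℝ)).tendsto 0
    simp only [ne_eq, OfNat.ofNat_ne_zero, not_false_eq_true, zero_pow] at h
    exact h.mono_left nhdsWithin_le_nhds
  -- the quotient of derivatives `(h t − h(−t))/(2t) → L2`
  have hquot : Tendsto (fun t => (h t - h (-t)) / (2 * t)) (𝓝[>] 0) (𝓝 L2) := by
    have hs := hh'.tendsto_slope_zero
    -- `hs : Tendsto (fun t => t⁻¹ • (h (0 + t) - h 0)) (𝓝[≠] 0) (𝓝 L2)`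
    have hs1 : Tendsto (fun t => (h t - h 0) / t) (𝓝[>] 0) (𝓝 L2) := by
      have := hs.mono_left (nhdsWithin_mono _ (fun t (ht : t ∈ Ioi (0:ℝ)) => ne_of_gt ht))
      refine this.congr' (Eventually.of_forall fun t => ?_)
      simp [smul_eq_mul, div_eq_inv_mul]
    have hs2 : Tendsto (fun t => (h (-t) - h 0) / (-t)) (𝓝[>] 0) (𝓝 L2) := by
      have hneg : Tendsto (fun t : ℝ => -t) (𝓝[>] 0) (𝓝[≠] 0) := by
        refine tendsto_nhdsWithin_of_tendsto_nhds_of_eventually_within _ ?_ ?_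
        · have : Tendsto (fun t : ℝ => -t) (𝓝 0) (𝓝 0) := by
            simpa using (continuous_neg (G := ℝ)).tendsto 0
          exact this.mono_left nhdsWithin_le_nhds
        · filter_upwards [self_mem_nhdsWithin] with t ht
          exact neg_ne_zero.2 (ne_of_gt ht)
      have := hs.comp hneg
      refine this.congr' (Eventually.of_forall fun t => ?_)
      simp [smul_eq_mul, div_eq_inv_mul]
    have hsum := hs1.add hs2
    have e : L2 = (L2 + L2) / 2 := by ring
    rw [e]
    refine (hsum.div_const 2).congr' ?_
    filter_upwards [self_mem_nhdsWithin] with t ht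
    have ht0 : t ≠ 0 := ne_of_gt ht
    field_simp
    ring
  have hmain := HasDerivAt.lhopital_zero_nhdsGT hN' hD' hD0 hN0 hDlim hquot
  refine hmain.congr' (Eventually.of_forall fun t => ?_)
  simp only [hg, he, neg_smul, coordLine_zero]

end TopEig

end Summit.NavierStokesRegularity.FunctionalMining

end
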